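import Summits.QuantumFields.YangMills.Theorems.AllWindowsColdBoxBulkMidSandwichLocalisedWhitening
import Summits.QuantumFields.YangMills.Theorems.SandwichVariancePinchingGaussianVarianceNonneg

/-!
# The LOCALISED quadratic covariance comparison
# (crux idea `logconcave-core-extension` on ⟨stmt-QuantumFields-24006⟩ `AllWindowsColdBox.BulkMidWindowSU2` — the
# card's IDEA-NEEDED leaf «localised QCC on a convex body at the intrinsic `r_K`», which removes its Cheapest
# falsifier (1): S7's quad×quad error `C·r_U` becomes `C·(r_K + r_U·μ_A(Kᶜ)^{1/4})`)

`localisedQuadraticCovarianceComparison`: for `H₀ ≻ 0`, `0 ≤ δ_K ≤ δ ≤ ½`, symmetric `H_f, H_g`, vectors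
`b_f, b_g`, `A ∈ C²(ℝⁿ)` with the GLOBAL second-difference sandwich `(1 ± δ)·hᵀH₀h`, the centring
`∫x_i e^{−A} = 0`, and on a measurable core `K` the Hessian pinching `(1 − δ_K)vᵀH₀v ≤ D²A(x)(v,v) ≤ (1 + δ_K)vᵀH₀v`:

  `|gE(f·g) − gE(f)·gE(g) − rC| ≤ 168·(δ_K + δ·p^{1/4})·√(rV_f · rV_g)`,  `p = ∫_{Kᶜ}e^{−A} / ∫e^{−A}`,

with `f = xᵀH_fx + b_f·x`, `g` likewise, `rC = 2tr(H₀⁻¹H_fH₀⁻¹H_g) + b_fᵀH₀⁻¹b_g`, `rV_f`, `rV_g` the Gaussian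
variances — i.e. the BODY of the landed crux `LogConcaveChart.QuadraticCovarianceComparison` (⟨26240⟩ ✓, there
with error `C·δ`) with the global sandwich constant replaced by the CORE constant `δ_K` up to the fourth root of
the off-core Gibbs mass; constants dimension-free.  `C²` input (the card's consumer feeds the `C²` surrogate of
`localToGlobalSandwich_posDef_C2`, ✓p788082).  PROOF: the planner's polarisation (`u, w = t·f ± t⁻¹·g`) and
scaling (`t² = √(rV_g/rV_f)`) argument of `quadraticCovarianceComparison_of_pinchings`, run on the localised
pinching `pinching_localised_posDef`.

HONEST SCOPE.  Free-hands work of the LEAD seat of ⟨stmt-QuantumFields-24006⟩ (FCL lineage) on an ingredient of an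
UN-TRIAGED crux idea card; classical log-concave probability.  It proves no stub of LINE-18 (S6/S7 need the
YM-specific pieces P1/P3/P4 of the card), no crux, rung or summit; the Yang–Mills mass gap is NOT proved.
-/

noncomputable section

namespace Summit.QuantumFields.YangMills.Theorems.SandwichVariancePinching

open MeasureTheory Real Set
open scoped Matrix
open Summit.QuantumFields.YangMills.Theses.SandwichVariancePinching (GaussianVarianceNonneg)

variable {n : ℕ}

/-- **POLARISED FORM** of the localised covariance comparison: for every `t > 0`,
`|gE(fg) − gE(f)gE(g) − rC| ≤ 84·ρ·(t²·rV_f + t⁻²·rV_g)` (polarisation `u, w = t·f ± t⁻¹·g` of the localised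
pinching `pinching_localised_posDef`). [folklore] -/
theorem covariance_polarised_localised {H₀ : Matrix (Fin n) (Fin n) ℝ} (hH₀ : H₀.PosDef)
    {δ : ℝ} (hδ : 0 ≤ δ) (hδ2 : δ ≤ 1 / 2) {δK : ℝ} (hδK : 0 ≤ δK) (hδKδ : δK ≤ δ)
    (Hf Hg : Matrix (Fin n) (Fin n) ℝ) (bf bg : Fin n → ℝ) {A : (Fin n → ℝ) → ℝ}
    (hHf : Hf.IsSymm) (hHg : Hg.IsSymm) (hA : ContDiff ℝ 2 A)
    (hsw : ∀ x h : Fin n → ℝ, (1 - δ) * (h ⬝ᵥ H₀ *ᵥ h) ≤ A (x + h) + A (x - h) - 2 * A x ∧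
      A (x + h) + A (x - h) - 2 * A x ≤ (1 + δ) * (h ⬝ᵥ H₀ *ᵥ h))
    (hcent : ∀ i : Fin n, ∫ x, x i * exp (-A x) = 0)
    {K : Set (Fin n → ℝ)} (hK : MeasurableSet K)
    (hloc : ∀ x ∈ K, ∀ v : Fin n → ℝ, (1 - δK) * (v ⬝ᵥ H₀ *ᵥ v) ≤ fderiv ℝ (fderiv ℝ A) x v v ∧
      fderiv ℝ (fderiv ℝ A) x v v ≤ (1 + δK) * (v ⬝ᵥ H₀ *ᵥ v)) (t : ℝ) (ht : 0 < t) :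
    |(∫ x, (x ⬝ᵥ Hf *ᵥ x + bf ⬝ᵥ x) * (x ⬝ᵥ Hg *ᵥ x + bg ⬝ᵥ x) * exp (-A x)) / (∫ x, exp (-A x)) -
        (∫ x, (x ⬝ᵥ Hf *ᵥ x + bf ⬝ᵥ x) * exp (-A x)) / (∫ x, exp (-A x)) *
          ((∫ x, (x ⬝ᵥ Hg *ᵥ x + bg ⬝ᵥ x) * exp (-A x)) / (∫ x, exp (-A x))) -
        (2 * (H₀⁻¹ * Hf * H₀⁻¹ * Hg).trace + bf ⬝ᵥ H₀⁻¹ *ᵥ bg)| ≤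
      (168 * (δK + δ * Real.sqrt (Real.sqrt ((∫ x in Kᶜ, exp (-A x)) / ∫ x, exp (-A x)))) / 2) *
        (t ^ 2 * (2 * (H₀⁻¹ * Hf * H₀⁻¹ * Hf).trace + bf ⬝ᵥ H₀⁻¹ *ᵥ bf) + t⁻¹ ^ 2 * (2 * (H₀⁻¹ * Hg * H₀⁻¹ * Hg).trace + bg ⬝ᵥ H₀⁻¹ *ᵥ bg)) := by
  have hN : GaussianVarianceNonneg := sandwichVariancePinching_gaussianVarianceNonneg_proof
  have hδlt1 : δ < 1 := by linarith
  obtain ⟨-, hZpos, hImom⟩ := sandwichMoments_of_lt_one δ hδ hδlt1 n H₀ A hH₀ hA.continuous hsw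
  set ρ : ℝ := (δK + δ * Real.sqrt (Real.sqrt ((∫ x in Kᶜ, exp (-A x)) / ∫ x, exp (-A x)))) with hρ
  have hρ0 : 0 ≤ ρ := by rw [hρ]; positivity
  set E : (Fin n → ℝ) → ℝ := fun x => exp (-A x) with hE
  set F : (Fin n → ℝ) → ℝ := fun x => x ⬝ᵥ Hf *ᵥ x + bf ⬝ᵥ x with hF
  set G : (Fin n → ℝ) → ℝ := fun x => x ⬝ᵥ Hg *ᵥ x + bg ⬝ᵥ x with hG
  have eE : ∀ x, exp (-A x) = E x := fun x => rfl
  have eF : ∀ x, x ⬝ᵥ Hf *ᵥ x + bf ⬝ᵥ x = F x := fun x => rfl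
  have eG : ∀ x, x ⬝ᵥ Hg *ᵥ x + bg ⬝ᵥ x = G x := fun x => rfl
  simp only [eF, eG]
  simp only [eE]
  set Z : ℝ := ∫ x, E x with hZ
  set If : ℝ := ∫ x, F x * E x
  set Ig : ℝ := ∫ x, G x * E x
  set Ifg : ℝ := ∫ x, F x * G x * E x
  set Iff : ℝ := ∫ x, F x * F x * E x
  set Igg : ℝ := ∫ x, G x * G x * E x
  set rC : ℝ := 2 * (H₀⁻¹ * Hf * H₀⁻¹ * Hg).trace + bf ⬝ᵥ H₀⁻¹ *ᵥ bg with hrC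
  set rVf : ℝ := 2 * (H₀⁻¹ * Hf * H₀⁻¹ * Hf).trace + bf ⬝ᵥ H₀⁻¹ *ᵥ bf with hrVf
  set rVg : ℝ := 2 * (H₀⁻¹ * Hg * H₀⁻¹ * Hg).trace + bg ⬝ᵥ H₀⁻¹ *ᵥ bg with hrVg
  have iF : Integrable (fun x => F x * E x) := (hImom Hf Hf bf bf).1
  have iG : Integrable (fun x => G x * E x) := (hImom Hg Hg bg bg).1
  have iFF : Integrable (fun x => F x * F x * E x) := (hImom Hf Hf bf bf).2
  have iFG : Integrable (fun x => F x * G x * E x) := (hImom Hf Hg bf bg).2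
  have iGG : Integrable (fun x => G x * G x * E x) := (hImom Hg Hg bg bg).2
  have hH₀invT : (H₀⁻¹)ᵀ = H₀⁻¹ := by
    have h := hH₀.1.inv
    unfold Matrix.IsHermitian at h
    rwa [Matrix.conjTranspose_eq_transpose_of_trivial] at h
  have htr : (H₀⁻¹ * Hg * H₀⁻¹ * Hf).trace = (H₀⁻¹ * Hf * H₀⁻¹ * Hg).trace := by
    rw [Matrix.mul_assoc (H₀⁻¹ * Hg) H₀⁻¹ Hf, Matrix.trace_mul_comm, ← Matrix.mul_assoc]
  have hbsym : bg ⬝ᵥ H₀⁻¹ *ᵥ bf = bf ⬝ᵥ H₀⁻¹ *ᵥ bg := by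
    rw [Matrix.dotProduct_mulVec, ← Matrix.mulVec_transpose, hH₀invT, dotProduct_comm]
  have ht0 : t ≠ 0 := ne_of_gt ht
  have main : ∀ s : ℝ, s = t⁻¹ ∨ s = -t⁻¹ →
      (1 - 17 * ρ) * (t ^ 2 * rVf + 2 * (t * s) * rC + s ^ 2 * rVg) ≤
        (t ^ 2 * Iff + 2 * (t * s) * Ifg + s ^ 2 * Igg) / Z - (t * If + s * Ig) / Z * ((t * If + s * Ig) / Z) ∧
      (t ^ 2 * Iff + 2 * (t * s) * Ifg + s ^ 2 * Igg) / Z - (t * If + s * Ig) / Z * ((t * If + s * Ig) / Z) ≤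
        (1 + 168 * ρ) * (t ^ 2 * rVf + 2 * (t * s) * rC + s ^ 2 * rVg) ∧
      0 ≤ t ^ 2 * rVf + 2 * (t * s) * rC + s ^ 2 * rVg := by
    intro s _
    set Hu : Matrix (Fin n) (Fin n) ℝ := t • Hf + s • Hg with hHu
    set bu : Fin n → ℝ := t • bf + s • bg with hbu
    have hHu_s : Hu.IsSymm := (hHf.smul t).add (hHg.smul s)
    have hqu : ∀ x : Fin n → ℝ, x ⬝ᵥ Hu *ᵥ x + bu ⬝ᵥ x = t * F x + s * G x := by
      intro x
      simp only [hHu, hbu, hF, hG, Matrix.add_mulVec, Matrix.smul_mulVec, dotProduct_add, dotProduct_smul,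
        add_dotProduct, smul_dotProduct, smul_eq_mul]
      ring
    have i1 : Integrable (fun x => t * (F x * E x)) := iF.const_mul t
    have i2 : Integrable (fun x => s * (G x * E x)) := iG.const_mul s
    have hI1 : ∫ x, (x ⬝ᵥ Hu *ᵥ x + bu ⬝ᵥ x) * E x = t * If + s * Ig := by
      have : (fun x => (x ⬝ᵥ Hu *ᵥ x + bu ⬝ᵥ x) * E x) = fun x => t * (F x * E x) + s * (G x * E x) := by
        funext x; rw [hqu x]; ring
      rw [this, integral_add i1 i2, integral_const_mul, integral_const_mul]
    have j1 : Integrable (fun x => t ^ 2 * (F x * F x * E x)) := iFF.const_mul _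
    have j2 : Integrable (fun x => 2 * (t * s) * (F x * G x * E x)) := iFG.const_mul _
    have j3 : Integrable (fun x => s ^ 2 * (G x * G x * E x)) := iGG.const_mul _
    have j12 : Integrable (fun x => t ^ 2 * (F x * F x * E x) + 2 * (t * s) * (F x * G x * E x)) := j1.add j2
    have hI2 : ∫ x, (x ⬝ᵥ Hu *ᵥ x + bu ⬝ᵥ x) * (x ⬝ᵥ Hu *ᵥ x + bu ⬝ᵥ x) * E x =
        t ^ 2 * Iff + 2 * (t * s) * Ifg + s ^ 2 * Igg := by
      have : (fun x => (x ⬝ᵥ Hu *ᵥ x + bu ⬝ᵥ x) * (x ⬝ᵥ Hu *ᵥ x + bu ⬝ᵥ x) * E x) =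
          fun x => t ^ 2 * (F x * F x * E x) + 2 * (t * s) * (F x * G x * E x) + s ^ 2 * (G x * G x * E x) := by
        funext x; rw [hqu x]; ring
      rw [this, integral_add j12 j3, integral_add j1 j2, integral_const_mul, integral_const_mul,
        integral_const_mul]
    have hrVu : 2 * (H₀⁻¹ * Hu * H₀⁻¹ * Hu).trace + bu ⬝ᵥ H₀⁻¹ *ᵥ bu =
        t ^ 2 * rVf + 2 * (t * s) * rC + s ^ 2 * rVg := by
      simp only [hHu, hbu, hrVf, hrVg, hrC, Matrix.mul_add, Matrix.add_mul, Matrix.mul_smul, Matrix.smul_mul,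
        Matrix.trace_add, Matrix.trace_smul, smul_eq_mul, Matrix.mulVec_add, Matrix.mulVec_smul, dotProduct_add,
        dotProduct_smul, add_dotProduct, smul_dotProduct, htr, hbsym]
      ring
    have hpin := pinching_localised_posDef hH₀ hδ hδ2 Hu bu hHu_s hA hsw hcent hK hδK hδKδ hloc
    simp only [eE] at hpin
    rw [← hZ, ← hρ] at hpin
    obtain ⟨hu2, hu1⟩ := hpin
    rw [hI2, hI1, hrVu] at hu1 hu2
    exact ⟨hu2, hu1, by rw [← hrVu]; exact hN n H₀ Hu bu hH₀ hHu_s⟩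
  obtain ⟨hu2, hu1, hRu0⟩ := main t⁻¹ (Or.inl rfl)
  obtain ⟨hw2, hw1, hRw0⟩ := main (-t⁻¹) (Or.inr rfl)
  have htt : t * t⁻¹ = 1 := mul_inv_cancel₀ ht0
  set Ru : ℝ := t ^ 2 * rVf + 2 * (t * t⁻¹) * rC + t⁻¹ ^ 2 * rVg with hRu
  set Rw : ℝ := t ^ 2 * rVf + 2 * (t * -t⁻¹) * rC + (-t⁻¹) ^ 2 * rVg with hRw
  have e2 : 17 * ρ * Ru ≤ 168 * ρ * Ru := mul_le_mul_of_nonneg_right (by nlinarith) hRu0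
  have e4 : 17 * ρ * Rw ≤ 168 * ρ * Rw := mul_le_mul_of_nonneg_right (by nlinarith) hRw0
  have hcov : Ifg / Z - (If / Z) * (Ig / Z) =
      (((t ^ 2 * Iff + 2 * (t * t⁻¹) * Ifg + t⁻¹ ^ 2 * Igg) / Z - (t * If + t⁻¹ * Ig) / Z * ((t * If + t⁻¹ * Ig) / Z))
        - ((t ^ 2 * Iff + 2 * (t * -t⁻¹) * Ifg + (-t⁻¹) ^ 2 * Igg) / Z
            - (t * If + -t⁻¹ * Ig) / Z * ((t * If + -t⁻¹ * Ig) / Z))) / 4 := by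
    have hZne : Z ≠ 0 := ne_of_gt hZpos
    rw [htt]; field_simp; ring
  have hR1 : rC = (Ru - Rw) / 4 := by rw [hRu, hRw]; field_simp; ring
  have hR2 : t ^ 2 * rVf + t⁻¹ ^ 2 * rVg = (Ru + Rw) / 2 := by rw [hRu, hRw]; ring
  rw [hcov, hR1, hR2, abs_le]
  constructor
  · linarith [hu1, hu2, hw1, hw2, e2, e4]
  · linarith [hu1, hu2, hw1, hw2, e2, e4]

/-- **THE LOCALISED QUADRATIC COVARIANCE COMPARISON** (see the module docstring):
`|gE(fg) − gE(f)gE(g) − rC| ≤ 168·(δ_K + δ·(∫_{Kᶜ}e^{−A}/∫e^{−A})^{1/4})·√(rV_f·rV_g)`. [folklore] -/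
theorem localisedQuadraticCovarianceComparison {H₀ : Matrix (Fin n) (Fin n) ℝ} (hH₀ : H₀.PosDef)
    {δ : ℝ} (hδ : 0 ≤ δ) (hδ2 : δ ≤ 1 / 2) {δK : ℝ} (hδK : 0 ≤ δK) (hδKδ : δK ≤ δ)
    (Hf Hg : Matrix (Fin n) (Fin n) ℝ) (bf bg : Fin n → ℝ) {A : (Fin n → ℝ) → ℝ}
    (hHf : Hf.IsSymm) (hHg : Hg.IsSymm) (hA : ContDiff ℝ 2 A)
    (hsw : ∀ x h : Fin n → ℝ, (1 - δ) * (h ⬝ᵥ H₀ *ᵥ h) ≤ A (x + h) + A (x - h) - 2 * A x ∧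
      A (x + h) + A (x - h) - 2 * A x ≤ (1 + δ) * (h ⬝ᵥ H₀ *ᵥ h))
    (hcent : ∀ i : Fin n, ∫ x, x i * exp (-A x) = 0)
    {K : Set (Fin n → ℝ)} (hK : MeasurableSet K)
    (hloc : ∀ x ∈ K, ∀ v : Fin n → ℝ, (1 - δK) * (v ⬝ᵥ H₀ *ᵥ v) ≤ fderiv ℝ (fderiv ℝ A) x v v ∧
      fderiv ℝ (fderiv ℝ A) x v v ≤ (1 + δK) * (v ⬝ᵥ H₀ *ᵥ v)) :
    |(∫ x, (x ⬝ᵥ Hf *ᵥ x + bf ⬝ᵥ x) * (x ⬝ᵥ Hg *ᵥ x + bg ⬝ᵥ x) * exp (-A x)) / (∫ x, exp (-A x)) -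
        (∫ x, (x ⬝ᵥ Hf *ᵥ x + bf ⬝ᵥ x) * exp (-A x)) / (∫ x, exp (-A x)) *
          ((∫ x, (x ⬝ᵥ Hg *ᵥ x + bg ⬝ᵥ x) * exp (-A x)) / (∫ x, exp (-A x))) -
        (2 * (H₀⁻¹ * Hf * H₀⁻¹ * Hg).trace + bf ⬝ᵥ H₀⁻¹ *ᵥ bg)| ≤
      168 * (δK + δ * Real.sqrt (Real.sqrt ((∫ x in Kᶜ, exp (-A x)) / ∫ x, exp (-A x)))) *
        Real.sqrt ((2 * (H₀⁻¹ * Hf * H₀⁻¹ * Hf).trace + bf ⬝ᵥ H₀⁻¹ *ᵥ bf) *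
          (2 * (H₀⁻¹ * Hg * H₀⁻¹ * Hg).trace + bg ⬝ᵥ H₀⁻¹ *ᵥ bg)) := by
  have hN : GaussianVarianceNonneg := sandwichVariancePinching_gaussianVarianceNonneg_proof
  have key := covariance_polarised_localised hH₀ hδ hδ2 hδK hδKδ Hf Hg bf bg hHf hHg hA hsw hcent hK hloc
  set ρ : ℝ := (δK + δ * Real.sqrt (Real.sqrt ((∫ x in Kᶜ, exp (-A x)) / ∫ x, exp (-A x)))) with hρ
  have hρ0 : 0 ≤ ρ := by rw [hρ]; positivity
  set X : ℝ := |(∫ x, (x ⬝ᵥ Hf *ᵥ x + bf ⬝ᵥ x) * (x ⬝ᵥ Hg *ᵥ x + bg ⬝ᵥ x) * exp (-A x)) / (∫ x, exp (-A x)) -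
        (∫ x, (x ⬝ᵥ Hf *ᵥ x + bf ⬝ᵥ x) * exp (-A x)) / (∫ x, exp (-A x)) *
          ((∫ x, (x ⬝ᵥ Hg *ᵥ x + bg ⬝ᵥ x) * exp (-A x)) / (∫ x, exp (-A x))) -
        (2 * (H₀⁻¹ * Hf * H₀⁻¹ * Hg).trace + bf ⬝ᵥ H₀⁻¹ *ᵥ bg)| with hX
  set rVf : ℝ := 2 * (H₀⁻¹ * Hf * H₀⁻¹ * Hf).trace + bf ⬝ᵥ H₀⁻¹ *ᵥ bf with hrVf
  set rVg : ℝ := 2 * (H₀⁻¹ * Hg * H₀⁻¹ * Hg).trace + bg ⬝ᵥ H₀⁻¹ *ᵥ bg with hrVg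
  have hrVf0 : 0 ≤ rVf := hN n H₀ Hf bf hH₀ hHf
  have hrVg0 : 0 ≤ rVg := hN n H₀ Hg bg hH₀ hHg
  -- scaling
  have hC0 : 0 ≤ 168 * ρ / 2 := by positivity
  rcases eq_or_lt_of_le hrVf0 with hf0 | hfpos
  · have hsq : Real.sqrt (rVf * rVg) = 0 := by rw [← hf0]; simp
    rw [hsq, mul_zero]
    have hXs : ∀ s : ℝ, 0 < s → X ≤ (168 * ρ / 2) * rVg / s := by
      intro s hs
      have hks := key (Real.sqrt s) (Real.sqrt_pos.mpr hs)
      rw [← hf0, mul_zero, zero_add, inv_pow, Real.sq_sqrt hs.le] at hks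
      calc _ ≤ (168 * ρ / 2) * (s⁻¹ * rVg) := hks
        _ = (168 * ρ / 2) * rVg / s := by field_simp
    exact le_zero_of_forall_le_div (mul_nonneg hC0 hrVg0) hXs
  rcases eq_or_lt_of_le hrVg0 with hg0 | hgpos
  · have hsq : Real.sqrt (rVf * rVg) = 0 := by rw [← hg0]; simp
    rw [hsq, mul_zero]
    have hXs : ∀ s : ℝ, 0 < s → X ≤ (168 * ρ / 2) * rVf / s := by
      intro s hs
      have hks := key ((Real.sqrt s)⁻¹) (inv_pos.mpr (Real.sqrt_pos.mpr hs))
      rw [← hg0, mul_zero, add_zero, inv_pow, Real.sq_sqrt hs.le] at hks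
      calc _ ≤ (168 * ρ / 2) * (s⁻¹ * rVf) := hks
        _ = (168 * ρ / 2) * rVf / s := by field_simp
    exact le_zero_of_forall_le_div (mul_nonneg hC0 hrVf0) hXs
  have hsf : 0 < Real.sqrt rVf := Real.sqrt_pos.mpr hfpos
  have hsg : 0 < Real.sqrt rVg := Real.sqrt_pos.mpr hgpos
  have hmain := key (Real.sqrt (Real.sqrt rVg / Real.sqrt rVf)) (Real.sqrt_pos.mpr (div_pos hsg hsf))
  have ht2 : Real.sqrt (Real.sqrt rVg / Real.sqrt rVf) ^ 2 = Real.sqrt rVg / Real.sqrt rVf :=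
    Real.sq_sqrt (div_pos hsg hsf).le
  have hff : Real.sqrt rVf * Real.sqrt rVf = rVf := Real.mul_self_sqrt hrVf0
  have hgg : Real.sqrt rVg * Real.sqrt rVg = rVg := Real.mul_self_sqrt hrVg0
  have h1' : Real.sqrt (Real.sqrt rVg / Real.sqrt rVf) ^ 2 * rVf = Real.sqrt rVf * Real.sqrt rVg := by
    rw [ht2]
    have hh : Real.sqrt rVg / Real.sqrt rVf * rVf =
        Real.sqrt rVg / Real.sqrt rVf * (Real.sqrt rVf * Real.sqrt rVf) := by rw [hff]
    rw [hh]; field_simp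
  have h2' : (Real.sqrt (Real.sqrt rVg / Real.sqrt rVf))⁻¹ ^ 2 * rVg = Real.sqrt rVf * Real.sqrt rVg := by
    rw [inv_pow, ht2, inv_div]
    have hh : Real.sqrt rVf / Real.sqrt rVg * rVg =
        Real.sqrt rVf / Real.sqrt rVg * (Real.sqrt rVg * Real.sqrt rVg) := by rw [hgg]
    rw [hh]; field_simp
  rw [h1', h2'] at hmain
  rw [Real.sqrt_mul hrVf0]
  linarith

end Summit.QuantumFields.YangMills.Theorems.SandwichVariancePinching

end
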